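/-
Copyright: literature formalisation for the harness. Statements follow the cited text.
-/
import Literature.AlgebraicGeometry.CossartPiltant200819.InseparableClimb2008
import Mathlib.FieldTheory.Galois.Infinite
import Mathlib.GroupTheory.Sylow
import Mathlib.GroupTheory.IndexNormal
import Mathlib.Data.Nat.Prime.Pow
import HarnessLib

/-!
# Cossart–Piltant I (2008), Thm 7.2 — clauses T-b(p-part) and T-f(Galois): the `p`-group climb

Sequel to `InseparableClimb2008`. In the proof of Thm 7.2 (HAL p. 21) the segment
`K₀ʳ ⊆ K ʳ` of the tower lies inside the finite Galois extension `L/K₀ʳ` whose group is the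
ramification group `G⁰_r`, a `p`-group; since a `p`-group is nilpotent, "`K ʳ/K₀ʳ` is a tower of
Galois extensions of degree `p`" (via the subgroups `H'_j = ⟨G_r, H_j⟩`), and the valuation ring
is unique at each floor because every floor contains the decomposition field.

PROVED here (kernel-checked, no `sorry`), in the abstract-stage idiom of `Tower2008`, the general
statement behind this paragraph:

* `CReach3.of_isPGroup` — let `L/F` be finite Galois with `Gal(L/F)` a `p`-group (`p = char k`)
  and let `W` be a valuation ring of `L` containing `k` and fixed by EVERY `σ ∈ Gal(L/F)`. Then for
  every intermediate field `B`, the stage `(F, W ∩ F)` reaches `(B, W ∩ B)` by `galoisStep`s.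
  (Apply with `F = K₀ʳ`, `B = K ʳ`: `Gal(L/K₀ʳ) = G⁰_r ⊆ G⁰_Z` fixes `W`.)

The group theory is Sylow's theorem in the form "a subgroup of order `p^j` of a `p`-group lies in
one of order `p^{j+1}`" (`Sylow.exists_subgroup_card_pow_succ`), normality of index-`p` subgroups
of `p`-groups, and the Galois correspondence; uniqueness of the valuation ring at each floor is
`comap_eq_of_forall_smul_eq` (`TowerInheritance2008`). Supporting lemmas:
`isGalois_extendScalars_of_conj_mem` (a relative Galois sub-step from a normality condition),
`finrank_eq_card_fixingSubgroup`, `forall_smul_eq_of_restrictScalars`, `CReach3.toBotStage`.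

With `InseparableClimb2008` this discharges T-a(ii)′, T-b(p-part) and T-f entirely; what remains
NAMED in `CoarseTowerExists2008` is the prime-to-`p` abelian segment `K₀ⁱ ⊆ K₀ʳ` (T-b, tame part:
cyclic steps of prime degree `ℓ ≠ p` with `e = ℓ`) and the assembly along (9) (T-g).
[cite: CossartPiltant2008, Thm 7.2 proof (HAL p. 21)]
-/

namespace Literature.AlgebraicGeometry.CossartPiltant200819.CP2008

open Literature.AlgebraicGeometry.Resolution IsLocalRing IntermediateField
open scoped Pointwise IntermediateField

universe u

section GaloisLemmas

variable {F L : Type u} [Field F] [Field L] [Algebra F L]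

/-- **A relative Galois sub-step**: for intermediate fields `B₁ ≤ B` of a Galois extension
`L/F`, if `Gal(L/B₁)` normalises `Gal(L/B)` then `B/B₁` is Galois. [folklore] -/
theorem isGalois_extendScalars_of_conj_mem [IsGalois F L] {B₁ B : IntermediateField F L}
    (hle : B₁ ≤ B)
    (hnorm : ∀ h g : L ≃ₐ[F] L, h ∈ B.fixingSubgroup → g ∈ B₁.fixingSubgroup →
      g * h * g⁻¹ ∈ B.fixingSubgroup) :
    IsGalois B₁ (extendScalars hle) := by
  rw [← InfiniteGalois.normal_iff_isGalois]
  refine ⟨fun φ hφ ψ => ?_⟩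
  rw [IntermediateField.mem_fixingSubgroup_iff] at hφ ⊢
  intro x hx
  have hφ' : φ.restrictScalars F ∈ B.fixingSubgroup := by
    rw [IntermediateField.mem_fixingSubgroup_iff]
    intro y hy
    exact hφ y hy
  have hψ' : ψ.restrictScalars F ∈ B₁.fixingSubgroup := by
    rw [IntermediateField.mem_fixingSubgroup_iff]
    intro y hy
    exact ψ.commutes ⟨y, hy⟩
  have := hnorm _ _ hφ' hψ'
  rw [IntermediateField.mem_fixingSubgroup_iff] at this
  exact this x hx

/-- `[L : B] = |Gal(L/B)|` read in `Gal(L/F)`. [folklore] -/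
theorem finrank_eq_card_fixingSubgroup [FiniteDimensional F L] [IsGalois F L]
    (B : IntermediateField F L) : Module.finrank B L = Nat.card B.fixingSubgroup := by
  rw [Nat.card_congr (IntermediateField.fixingSubgroupEquiv B).toEquiv,
    IsGalois.card_aut_eq_finrank]

/-- If every `F`-automorphism fixes the valuation ring `W`, so does every `B₁`-automorphism.
[folklore] -/
theorem forall_smul_eq_of_restrictScalars (B₁ : IntermediateField F L) (W : ValuationSubring L)
    (hW : ∀ σ : L ≃ₐ[F] L, σ • W = W) (σ : L ≃ₐ[B₁] L) : σ • W = W := by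
  ext x
  conv_rhs => rw [← hW (σ.restrictScalars F)]
  rw [ValuationSubring.mem_smul_pointwise_iff_exists,
    ValuationSubring.mem_smul_pointwise_iff_exists]
  exact Iff.rfl

end GaloisLemmas

section GroupLemmas

variable {G : Type*} [Group G]

/-- In a `p`-group, a subgroup `H ≤ N` with `|N| = p · |H|` is normal in `N`, of index `p`.
[folklore] -/
theorem normal_subgroupOf_of_card_eq {p : ℕ} (hp : p.Prime) {H N : Subgroup G} (hHN : H ≤ N)
    {j : ℕ} (hH : Nat.card H = p ^ j) (hN : Nat.card N = p ^ (j + 1)) :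
    (H.subgroupOf N).Normal ∧ (H.subgroupOf N).index = p := by
  have hcard : Nat.card (H.subgroupOf N) = p ^ j := by
    rw [Nat.card_congr (Subgroup.subgroupOfEquivOfLe hHN).toEquiv, hH]
  have hidx : (H.subgroupOf N).index = p := by
    have h := (H.subgroupOf N).index_mul_card
    rw [hcard, hN, pow_succ, mul_comm (p ^ j) p] at h
    exact Nat.eq_of_mul_eq_mul_right (pow_pos hp.pos j) h
  refine ⟨Subgroup.normal_of_index_eq_minFac_card ?_, hidx⟩
  rw [hidx, hN, hp.pow_minFac (Nat.succ_ne_zero j)]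

end GroupLemmas

section Climb

variable {k : Type u} [Field k]

/-- The bottom stage re-presented on `⊥ : IntermediateField F L`. [folklore] -/
theorem CReach3.toBotStage {F L : Type u} [Field F] [Algebra k F] [Field L] [Algebra F L]
    [Algebra k L] [IsScalarTower k F L] (W : ValuationSubring L)
    (hkW : ∀ c : k, algebraMap k L c ∈ W) :
    CReach3 k ⟨F, W.comap (algebraMap F L), forall_algebraMap_mem_comap hkW⟩
      ⟨(⊥ : IntermediateField F L), W.comap (algebraMap (⊥ : IntermediateField F L) L),
        forall_algebraMap_mem_comap_intermediateField hkW ⊥⟩ := by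
  haveI : IsScalarTower k F (⊥ : IntermediateField F L) := IsScalarTower.of_algebraMap_eq fun c =>
    Subtype.ext (by
      change algebraMap k L c = algebraMap F L (algebraMap k F c)
      exact IsScalarTower.algebraMap_apply k F L c)
  let e : (⊥ : IntermediateField F L) ≃ₐ[k] F := (IntermediateField.botEquiv F L).restrictScalars k
  have h := CReach3.of_algEquiv_symm (k := k) e (W.comap (algebraMap F L))
    (forall_algebraMap_mem_comap hkW)
  have hO : (W.comap (algebraMap F L)).comap (e : (⊥ : IntermediateField F L) →+* F) =
      W.comap (algebraMap (⊥ : IntermediateField F L) L) := by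
    ext x
    simp only [ValuationSubring.mem_comap, RingHom.coe_coe]
    rw [IsScalarTower.algebraMap_apply (⊥ : IntermediateField F L) F L x,
      IntermediateField.coe_algebraMap_over_bot]
    rfl
  rw [VState.mk_congr hO _ (forall_algebraMap_mem_comap_intermediateField hkW ⊥)] at h
  exact h

/-- **The `p`-group climb** (clauses T-b(p-part) + T-f, PROVED): `L/F` finite Galois with
`Gal(L/F)` a `p`-group, `p = char k`, `W` a valuation ring of `L` containing `k` and fixed by
every `σ ∈ Gal(L/F)`; then for every intermediate field `B` the stage `(F, W ∩ F)` reaches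
`(B, W ∩ B)` — along a chain `F = B⁽⁰⁾ ⊂ B⁽¹⁾ ⊂ ⋯ ⊂ B` of Galois steps of degree `p`, at each of
which the valuation ring is the unique extension. [cite: CossartPiltant2008, Thm 7.2 proof
(HAL p. 21)] -/
theorem CReach3.of_isPGroup (p : ℕ) (hp : p.Prime) (hchar : CharP k p) {F L : Type u} [Field F]
    [Algebra k F] [Field L] [Algebra F L] [Algebra k L] [IsScalarTower k F L]
    [FiniteDimensional F L] [IsGalois F L] (hP : IsPGroup p (L ≃ₐ[F] L))
    (W : ValuationSubring L) (hkW : ∀ c : k, algebraMap k L c ∈ W)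
    (hW : ∀ σ : L ≃ₐ[F] L, σ • W = W) (B : IntermediateField F L) :
    CReach3 k ⟨F, W.comap (algebraMap F L), forall_algebraMap_mem_comap hkW⟩
      ⟨B, W.comap (algebraMap B L), forall_algebraMap_mem_comap_intermediateField hkW B⟩ := by
  haveI : Fact p.Prime := ⟨hp⟩
  suffices hmain : ∀ (n : ℕ) (B : IntermediateField F L), B.fixingSubgroup.index = n →
      CReach3 k ⟨F, W.comap (algebraMap F L), forall_algebraMap_mem_comap hkW⟩
        ⟨B, W.comap (algebraMap B L), forall_algebraMap_mem_comap_intermediateField hkW B⟩ from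
    hmain _ B rfl
  intro n
  induction n using Nat.strong_induction_on with
  | _ n ih =>
  intro B hn
  by_cases htop : B.fixingSubgroup = ⊤
  · -- `B = ⊥`: one `iso` move
    have hB : B = ⊥ := by
      rw [← IsGalois.fixedField_fixingSubgroup B, htop, IsGalois.fixedField_top]
    subst hB
    exact CReach3.toBotStage W hkW
  -- a subgroup `N ⊇ H := Gal(L/B)` with `|N| = p |H|`; `B₁ := L^N ⊆ B`, `[B : B₁] = p`, Galois
  obtain ⟨j, hj⟩ := (hP.to_subgroup B.fixingSubgroup).exists_card_eq
  obtain ⟨i, hi⟩ := hP.index B.fixingSubgroup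
  have hi0 : i ≠ 0 := by
    rintro rfl
    rw [pow_zero, Subgroup.index_eq_one] at hi
    exact htop hi
  have hdvd : p ^ (j + 1) ∣ Nat.card (L ≃ₐ[F] L) := by
    rw [← B.fixingSubgroup.card_mul_index, hj, hi, ← pow_add]
    exact pow_dvd_pow p (by omega)
  obtain ⟨N, hN, hHN⟩ := Sylow.exists_subgroup_card_pow_succ hdvd hj
  obtain ⟨hnormal, hidx⟩ := normal_subgroupOf_of_card_eq hp hHN hj hN
  set B₁ : IntermediateField F L := fixedField N with hB₁
  have hNB₁ : B₁.fixingSubgroup = N := fixingSubgroup_fixedField N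
  have hle : B₁ ≤ B := fun x hx => by
    have hx' : x ∈ fixedField B.fixingSubgroup :=
      (mem_fixedField_iff _ x).mpr fun σ hσ => (mem_fixedField_iff _ x).mp hx σ (hHN hσ)
    rwa [IsGalois.fixedField_fixingSubgroup] at hx'
  -- induction hypothesis: reach `B₁`
  have hlt : B₁.fixingSubgroup.index < n := by
    rw [hNB₁, ← hn, ← Subgroup.relIndex_mul_index hHN]
    change N.index < (B.fixingSubgroup.subgroupOf N).index * N.index
    rw [hidx]
    have hpos : 0 < N.index := Nat.pos_of_ne_zero Subgroup.FiniteIndex.index_ne_zero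
    have h2 := hp.two_le
    nlinarith
  have reach₁ := ih _ hlt B₁ rfl
  -- the Galois step `B₁ ⊆ B` of degree `p`
  haveI : IsScalarTower k B₁ L := isScalarTower_intermediateField' (k := k) B₁
  have hgal : IsGalois B₁ (extendScalars hle) := by
    refine isGalois_extendScalars_of_conj_mem hle fun h g hh hg => ?_
    rw [hNB₁] at hg
    exact (Subgroup.normal_subgroupOf_iff hHN).mp hnormal h g hh hg
  have hdeg : Module.finrank B₁ (extendScalars hle) = p := by
    have htower := Module.finrank_mul_finrank B₁ (extendScalars hle) L
    have hxL : Module.finrank (extendScalars hle) L = Nat.card B.fixingSubgroup :=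
      finrank_eq_card_fixingSubgroup B
    have hB₁L : Module.finrank B₁ L = Nat.card N := by
      rw [hB₁]
      exact finrank_fixedField_eq_card N
    rw [hxL, hj, hB₁L, hN, pow_succ, mul_comm (p ^ j) p] at htower
    exact Nat.eq_of_mul_eq_mul_right (pow_pos hp.pos j) htower
  have hW₁ : ∀ σ : L ≃ₐ[B₁] L, σ • W = W := forall_smul_eq_of_restrictScalars B₁ W hW
  have step : CMove3 k
      ⟨B₁, W.comap (algebraMap B₁ L), forall_algebraMap_mem_comap_intermediateField hkW B₁⟩
      ⟨B, W.comap (algebraMap B L), forall_algebraMap_mem_comap_intermediateField hkW B⟩ :=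
    CMove3.galoisStep (W.comap (algebraMap B₁ L))
      (forall_algebraMap_mem_comap_intermediateField hkW B₁) p hp hchar (L := extendScalars hle)
      inferInstance hgal hdeg (W.comap (algebraMap (extendScalars hle) L))
      (forall_algebraMap_mem_comap_intermediateField hkW (extendScalars hle))
      (comap_comap_algebraMap (extendScalars hle) W)
      (fun W' hW' => comap_eq_of_forall_smul_eq W hW₁ (extendScalars hle) hW')
  exact Relation.ReflTransGen.tail reach₁ step

end Climb

end Literature.AlgebraicGeometry.CossartPiltant200819.CP2008
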